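import Literature.Computability.Cryptography.LWEProductLaws
import Literature.Probability.Distributions.IndepProductLaw
import HarnessLib

/-!
# Independent products of laws: splitting into blocks, the iid case, and laws determined by event bounds

Topic `Computability/Cryptography`; bridge between the independent product `indepLaw K p` of
`Probability/Distributions/IndepProductLaw.lean` (arbitrary laws `p j`) and the iid product
`LWE.iidPMF` of `LWE.lean` / `LWEProductLaws.lean`, in the exact `PMF` form consumed by reductions
that read the outputs of polynomially many independent sub-runs (Regev 2009, Lemma 3.17: of the
`(2n+2) · n²` independent sampler calls only the `n²` at the good radius matter, and those are iid):

* `indepLaw_const` — a constant family gives the iid product: `⨂_{j<K} q = q^{⊗K}`;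
* `indepLaw_append`, `indepLaw_map_appendEquiv_symm` — **splitting** `⨂_{j<a+b} p j` into its first
  `a` and last `b` coordinates gives the independent pair `(⨂_{j<a} p (castAdd j)) ⊗ (⨂_{j<b} p (natAdd j))`;
  hence the two marginals `indepLaw_map_castAdd`, `indepLaw_map_natAdd`;
* `PMF.eq_of_forall_toOuterMeasure_le` — **a law is determined by lower bounds on all events**: if
  `q S ≤ p S` for every event `S` then `p = q` (used to read an exact output LAW off a family of
  one-sided success guarantees, e.g. `CWrap.kernelProb_family_ge`).

## References

* W. Feller, *An Introduction to Probability Theory and Its Applications I*, 3rd ed., Wiley 1968,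
  Ch. IX §1 (independent trials; marginals of product probabilities) [folklore].
-/

noncomputable section

open scoped ENNReal

/-! ### Laws determined by one-sided event bounds -/

namespace PMF

variable {α : Type}

/-- **If `q S ≤ p S` for every event `S`, then `p = q`** (both have total mass `1`; apply the bound
to a singleton and to its complement). [folklore] -/
theorem eq_of_forall_toOuterMeasure_le {p q : PMF α} (h : ∀ S : Set α, q.toOuterMeasure S ≤ p.toOuterMeasure S) :
    p = q := by
  refine PMF.ext fun a => le_antisymm ?_ ?_
  · -- `p {a} = 1 - p {a}ᶜ ≤ 1 - q {a}ᶜ = q {a}`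
    have hp := Literature.Computability.Cryptography.LWE.one_sub_toOuterMeasure_compl p {a}
    have hq := Literature.Computability.Cryptography.LWE.one_sub_toOuterMeasure_compl q {a}
    rw [PMF.toOuterMeasure_apply_singleton] at hp hq
    rw [← hp, ← hq]
    exact tsub_le_tsub_left (h {a}ᶜ) 1
  · have h1 := h {a}
    rwa [PMF.toOuterMeasure_apply_singleton, PMF.toOuterMeasure_apply_singleton] at h1

end PMF

namespace Literature.Computability.Cryptography

namespace LWE

open Literature.Probability.Distributions

variable {α : Type}

/-! ### The iid case -/

/-- **A constant family of laws gives the iid product**: `indepLaw K (fun _ => q) = iidPMF q K`.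
[folklore] -/
theorem indepLaw_const (q : PMF α) (K : ℕ) : indepLaw K (fun _ => q) = iidPMF q K :=
  PMF.ext fun v => by rw [indepLaw_apply, iidPMF_apply_holds]

/-! ### Splitting an independent product into two blocks -/

/-- The mass of an appended tuple factors. [folklore] -/
theorem indepLaw_append {a b : ℕ} (p : Fin (a + b) → PMF α) (v₁ : Fin a → α) (v₂ : Fin b → α) :
    indepLaw (a + b) p (Fin.append v₁ v₂) =
      indepLaw a (fun j => p (Fin.castAdd b j)) v₁ * indepLaw b (fun j => p (Fin.natAdd a j)) v₂ := by
  simp only [indepLaw_apply, Fin.prod_univ_add, Fin.append_left, Fin.append_right]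

/-- **The first `a` and the last `b` coordinates of `⨂_{j<a+b} p j` are an independent pair** of
independent products. [folklore] -/
theorem indepLaw_map_appendEquiv_symm {a b : ℕ} (p : Fin (a + b) → PMF α) :
    (indepLaw (a + b) p).map (Fin.appendEquiv a b).symm =
      prodLaw (indepLaw a fun j => p (Fin.castAdd b j)) (indepLaw b fun j => p (Fin.natAdd a j)) := by
  ext ⟨v₁, v₂⟩
  rw [pmf_map_equiv_apply, Equiv.symm_symm]
  show indepLaw (a + b) p (Fin.append v₁ v₂) = _
  rw [prodLaw_apply, indepLaw_append]

/-- **Marginal on the first `a` coordinates.** [folklore] -/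
theorem indepLaw_map_castAdd {a b : ℕ} (p : Fin (a + b) → PMF α) :
    (indepLaw (a + b) p).map (fun v => fun j : Fin a => v (Fin.castAdd b j)) =
      indepLaw a fun j => p (Fin.castAdd b j) := by
  have h := congrArg (PMF.map Prod.fst) (indepLaw_map_appendEquiv_symm p)
  rw [prodLaw_map_fst, PMF.map_comp] at h
  convert h using 2
  funext v
  funext j
  simp [Fin.appendEquiv, Fin.append, Fin.castAdd]

/-- **Marginal on the last `b` coordinates.** [folklore] -/
theorem indepLaw_map_natAdd {a b : ℕ} (p : Fin (a + b) → PMF α) :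
    (indepLaw (a + b) p).map (fun v => fun j : Fin b => v (Fin.natAdd a j)) =
      indepLaw b fun j => p (Fin.natAdd a j) := by
  have h := congrArg (PMF.map Prod.snd) (indepLaw_map_appendEquiv_symm p)
  rw [prodLaw_map_snd, PMF.map_comp] at h
  convert h using 2
  funext v
  funext j
  simp [Fin.appendEquiv, Fin.append, Fin.natAdd]

/-- **Marginal on a middle block of coordinates**: in `⨂_{j<a+(b+c)} p j`, the coordinates
`a, …, a+b-1` are independent with laws `p (a + j)`; if moreover these laws are all equal to `q`,
the block is the iid product `q^{⊗b}`. [folklore] -/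
theorem indepLaw_map_middle_eq_iidPMF {a b c : ℕ} (p : Fin (a + (b + c)) → PMF α) (q : PMF α)
    (hq : ∀ j : Fin b, p (Fin.natAdd a (Fin.castAdd c j)) = q) :
    (indepLaw (a + (b + c)) p).map (fun v => fun j : Fin b => v (Fin.natAdd a (Fin.castAdd c j))) = iidPMF q b := by
  have h1 := indepLaw_map_natAdd (a := a) (b := b + c) p
  have h2 := indepLaw_map_castAdd (a := b) (b := c) (fun j => p (Fin.natAdd a j))
  have hcomp : (fun v : Fin (a + (b + c)) → α => fun j : Fin b => v (Fin.natAdd a (Fin.castAdd c j))) =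
      (fun w : Fin (b + c) → α => fun j : Fin b => w (Fin.castAdd c j)) ∘
        (fun v : Fin (a + (b + c)) → α => fun j : Fin (b + c) => v (Fin.natAdd a j)) := rfl
  rw [hcomp, ← PMF.map_comp, h1, h2, ← indepLaw_const]
  congr 1
  funext j
  exact hq j

end LWE

end Literature.Computability.Cryptography

end
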